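import Mathlib
import Literature.Algebra.Polynomial.JacobianCriterion
import HarnessLib

/-!
# The square Macaulay matrix of `k` forms in `k` variables and the vanishing of its determinant

Topic `Literature/RingTheory/MvPolynomial`. Cox–Little–O'Shea, *Using Algebraic Geometry* (2nd ed.,
GTM 185), Ch. 3 §4: for `n+1` forms `F_0, …, F_n` in `n+1` variables of degrees `d_i`, at the
critical degree `d = Σ (d_i − 1) + 1` every monomial `x^α` is divisible by some `x_i^{d_i}`, and
the square system `(x^α / x_i^{d_i}) · F_i = 0` ((4.1)) has a coefficient matrix whose determinant
`D_n` (Def. (4.2)) is a nonzero multiple of the resultant: it VANISHES whenever the `F_i` have a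
common nontrivial zero (Exercise 7(a)) and equals `±1` at `F_i = x_i^{d_i}` (Exercise 10). Here for
`k` forms of the SAME degree `δ` over a field `K`, with an arbitrary (choice-function) assignment
`α ↦ i = pick α`:

* `Macaulay.macaulay δ F` — the square matrix (rows/columns indexed by `mons k (k(δ-1)+1)`);
* `Macaulay.det_macaulay_eq_zero` — a common NONZERO zero of the `F_i` kills `det`;
* `Macaulay.macaulay_X_pow`, `det_macaulay_X_pow` — identity matrix at the Fermat point;
* `Macaulay.det_macaulay_grad_eq_zero`, `eq_zero_of_det_macaulay_grad_ne_zero` — the gradient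
  instance `F_i = ∂_i g` for a form `g` (`δ = deg g − 1`): `det M(∇g) ≠ 0` certifies that the
  projective hypersurface `g = 0` is smooth (no nonzero common zero of the partials).

WHAT THIS IS NOT: no resultant is defined (no divisibility `Res ∣ D_n`, Prop. (4.6), nor the
quotient formula Thm. (4.9)); unequal degrees are not treated.

Lean text authored by the cell `valiant-natproofs` planner seat p2 (gen 4,
HOME/MacaulayCertificate-p2g4.lean, farm rc 0), landed by the prover seat (used for natural proofs
against linear-size circuits, ledger item stmt-ValiantsHypothesis-20156).

## References

* [CoxLittleOSheaUsing2005] D. A. Cox, J. Little, D. O'Shea, *Using Algebraic Geometry*, 2nd ed.,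
  Springer GTM 185 (2005), Ch. 3 §4, (4.1), Def. (4.2), Exercises 7 and 10.
-/

open MvPolynomial Finset

namespace Literature.RingTheory.MvPolynomial

namespace Macaulay

variable {K : Type} [Field K]

/-- Monomials of degree `D` in `k` variables, as a finset of exponent vectors (the index set of the
Macaulay matrix). [cite: CoxLittleOSheaUsing2005, Ch. 3 §4, (4.1)–Def. (4.2)] -/
def mons (k D : ℕ) : Finset (Fin k →₀ ℕ) := (Finset.univ : Finset (Fin k)).finsuppAntidiag D

/-- Membership in `mons k D`: exponent vectors of degree `D`. [cite: CoxLittleOSheaUsing2005, Ch. 3 §4, (4.1)–Def. (4.2)] -/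
theorem mem_mons {k D : ℕ} {α : Fin k →₀ ℕ} : α ∈ mons k D ↔ α.degree = D := by
  classical
  rw [mons, Finset.mem_finsuppAntidiag, Finsupp.degree_eq_sum]
  simp

/-- Macaulay's critical degree `d = Σ_i (d_i - 1) + 1` for `k` forms of the same degree `δ`:
`k (δ - 1) + 1`. [cite: CoxLittleOSheaUsing2005, Ch. 3 §4, (4.1)–Def. (4.2)] -/
def critDeg (k δ : ℕ) : ℕ := k * (δ - 1) + 1

/-- Pigeonhole at the critical degree: every monomial of degree `k(δ-1)+1` is divisible by some
`x_i^δ` (CLO: the sets `S_i` cover all monomials of degree `d`). [cite: CoxLittleOSheaUsing2005, Ch. 3 §4, (4.1)–Def. (4.2)] -/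
theorem exists_le_of_mem_mons {k δ : ℕ} (α : mons k (critDeg k δ)) : ∃ i : Fin k, δ ≤ α.1 i := by
  by_contra h
  push Not at h
  have hdeg := mem_mons.1 α.2
  rw [Finsupp.degree_eq_sum] at hdeg
  unfold critDeg at hdeg
  have h2 : ∑ i, α.1 i ≤ ∑ _i : Fin k, (δ - 1) :=
    Finset.sum_le_sum fun i _ => by have := h i; omega
  simp only [sum_const, card_univ, Fintype.card_fin, smul_eq_mul] at h2
  omega

/-- A chosen index `i` with `α_i ≥ δ` (CLO's assignment of the monomial `x^α` to a set `S_i`; any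
choice works for the two facts below). [cite: CoxLittleOSheaUsing2005, Ch. 3 §4, (4.1)–Def. (4.2)] -/
noncomputable def pick {k δ : ℕ} (α : mons k (critDeg k δ)) : Fin k :=
  Classical.choose (exists_le_of_mem_mons α)

/-- The chosen index satisfies `α_{pick α} ≥ δ`. [cite: CoxLittleOSheaUsing2005, Ch. 3 §4, (4.1)–Def. (4.2)] -/
theorem le_pick {k δ : ℕ} (α : mons k (critDeg k δ)) : δ ≤ α.1 (pick α) :=
  Classical.choose_spec (exists_le_of_mem_mons α)

/-- `(α - δ e_i) + δ e_i = α` for `i = pick α`. [folklore] -/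
private theorem sub_single_add {k δ : ℕ} (α : mons k (critDeg k δ)) :
    α.1 - Finsupp.single (pick α) δ + Finsupp.single (pick α) δ = α.1 := by
  ext j
  have h := le_pick α
  simp only [Finsupp.coe_add, Finsupp.coe_tsub, Pi.add_apply, Pi.sub_apply,
    Finsupp.single_apply]
  split_ifs with hj
  · subst hj; omega
  · omega

/-- The cofactor monomial `x^α / x_i^δ` has degree `critDeg - δ`. [folklore] -/
private theorem degree_sub_single {k δ : ℕ} (α : mons k (critDeg k δ)) :
    (α.1 - Finsupp.single (pick α) δ).degree = critDeg k δ - δ := by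
  have h2 := congrArg Finsupp.degree (sub_single_add α)
  rw [map_add, Finsupp.degree_single, mem_mons.1 α.2] at h2
  omega

/-- `δ ≤ critDeg k δ` as soon as a monomial of the critical degree exists. [folklore] -/
private theorem le_critDeg {k δ : ℕ} (α : mons k (critDeg k δ)) : δ ≤ critDeg k δ := by
  have h1 := le_pick α
  have h2 := Finsupp.le_degree (pick α) α.1
  rw [mem_mons.1 α.2] at h2
  exact h1.trans h2

/-- The row polynomial `(x^α / x_i^δ) · F_i`, `i = pick α` (the left-hand sides of CLO's system (4.1)).
[cite: CoxLittleOSheaUsing2005, Ch. 3 §4, (4.1)–Def. (4.2)] -/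
noncomputable def rowPoly {k : ℕ} (δ : ℕ) (F : Fin k → MvPolynomial (Fin k) K)
    (α : mons k (critDeg k δ)) : MvPolynomial (Fin k) K :=
  monomial (α.1 - Finsupp.single (pick α) δ) 1 * F (pick α)

/-- **The square Macaulay matrix** of `k` forms of degree `δ` in `k` variables at the critical degree:
rows and columns indexed by the monomials of degree `k(δ-1)+1`, row `α` = the coefficient vector of
`(x^α / x_i^δ) · F_i`. Its determinant is CLO's `D_n` (for equal degrees). [cite: CoxLittleOSheaUsing2005, Ch. 3 §4, (4.1)–Def. (4.2)] -/
noncomputable def macaulay {k : ℕ} (δ : ℕ) (F : Fin k → MvPolynomial (Fin k) K) :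
    Matrix (mons k (critDeg k δ)) (mons k (critDeg k δ)) K :=
  fun α β => coeff β.1 (rowPoly δ F α)

/-- The row polynomials are forms of the critical degree. [cite: CoxLittleOSheaUsing2005, Ch. 3 §4, (4.1)–Def. (4.2)] -/
theorem isHomogeneous_rowPoly {k δ : ℕ} {F : Fin k → MvPolynomial (Fin k) K}
    (hF : ∀ i, (F i).IsHomogeneous δ) (α : mons k (critDeg k δ)) :
    (rowPoly δ F α).IsHomogeneous (critDeg k δ) := by
  have h := (isHomogeneous_monomial (1 : K) (degree_sub_single α)).mul (hF (pick α))
  rwa [Nat.sub_add_cancel (le_critDeg α)] at h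

/-- Evaluating a form of degree `D` = summing over the degree-`D` monomials. [folklore] -/
private theorem eval_eq_sum_mons {k D : ℕ} {P : MvPolynomial (Fin k) K} (hP : P.IsHomogeneous D)
    (ξ : Fin k → K) :
    eval ξ P = ∑ β : mons k D, coeff β.1 P * ∏ i, ξ i ^ β.1 i := by
  rw [eval_eq', Finset.sum_coe_sort (mons k D) (fun β => coeff β P * ∏ i, ξ i ^ β i)]
  apply Finset.sum_subset
  · intro d hd
    rw [mem_mons]
    by_contra hne
    exact (mem_support_iff.1 hd) (hP.coeff_eq_zero hne)
  · intro d _ hd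
    rw [notMem_support_iff.1 hd, zero_mul]

/-- **A common NONZERO zero of `k` forms of degree `δ` in `k` variables kills the Macaulay
determinant** (`M · (ξ^β)_β = 0` with `(ξ^β)_β ≠ 0`): CLO Ch. 3 §4 Exercise 7(a), "`D_n` vanishes
whenever `F_0 = ⋯ = F_n = 0` has a nontrivial solution". [cite: CoxLittleOSheaUsing2005, Ch. 3 §4, Exercise 7(a)] -/
theorem det_macaulay_eq_zero {k δ : ℕ} (F : Fin k → MvPolynomial (Fin k) K)
    (hF : ∀ i, (F i).IsHomogeneous δ) (ξ : Fin k → K) (hξ : ξ ≠ 0)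
    (h0 : ∀ i, eval ξ (F i) = 0) : (macaulay δ F).det = 0 := by
  classical
  let v : mons k (critDeg k δ) → K := fun β => ∏ i, ξ i ^ β.1 i
  refine Matrix.exists_mulVec_eq_zero_iff.1 ⟨v, ?_, ?_⟩
  · obtain ⟨j, hj⟩ := Function.ne_iff.1 hξ
    have hβ : Finsupp.single j (critDeg k δ) ∈ mons k (critDeg k δ) := by
      rw [mem_mons, Finsupp.degree_single]
    intro hv
    have h1 := congrFun hv ⟨_, hβ⟩
    simp only [v, Pi.zero_apply] at h1
    rw [Finset.prod_eq_single j, Finsupp.single_eq_same] at h1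
    · exact pow_ne_zero _ hj h1
    · intro i _ hi
      rw [Finsupp.single_eq_of_ne hi, pow_zero]
    · simp
  · funext α
    simp only [Matrix.mulVec, dotProduct, Pi.zero_apply]
    show ∑ β : mons k (critDeg k δ), coeff β.1 (rowPoly δ F α) * ∏ i, ξ i ^ β.1 i = 0
    rw [← eval_eq_sum_mons (isHomogeneous_rowPoly hF α) ξ, rowPoly, map_mul, h0, mul_zero]

/-- At the Fermat point `F_i = x_i^δ` the Macaulay matrix is the identity (so its determinant, a
polynomial in the coefficients of the `F_i`, is not identically zero): CLO Ch. 3 §4 Exercise 10,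
"`D_n(x_0^{d_0}, …, x_n^{d_n}) = ±1`". [cite: CoxLittleOSheaUsing2005, Ch. 3 §4, Exercise 10] -/
theorem macaulay_X_pow {k δ : ℕ} :
    macaulay (K := K) δ (fun i => (X i : MvPolynomial (Fin k) K) ^ δ) = 1 := by
  classical
  ext α β
  simp only [macaulay, rowPoly]
  rw [X_pow_eq_monomial, monomial_mul, one_mul, sub_single_add α, coeff_monomial,
    Matrix.one_apply]
  by_cases h : α = β
  · subst h; simp
  · have h' : α.1 ≠ β.1 := fun e => h (Subtype.ext e)
    simp [h, h']

/-- `det M(x_1^δ, …, x_k^δ) = 1`. [cite: CoxLittleOSheaUsing2005, Ch. 3 §4, Exercise 10] -/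
theorem det_macaulay_X_pow {k δ : ℕ} :
    (macaulay (K := K) δ (fun i => (X i : MvPolynomial (Fin k) K) ^ δ)).det = 1 := by
  rw [macaulay_X_pow, Matrix.det_one]

/-- The gradient instance: if `g` is a form of degree `d` and `∇g` has a common NONZERO zero, then
`det M(∂_1 g, …, ∂_k g) = 0` (Macaulay matrix for `δ = d - 1`; the discriminant-type certificate of a
singular projective hypersurface). [cite: CoxLittleOSheaUsing2005, Ch. 3 §4, Exercise 7(a)] -/
theorem det_macaulay_grad_eq_zero {k d : ℕ} (g : MvPolynomial (Fin k) K)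
    (hg : g.IsHomogeneous d) (ξ : Fin k → K) (hξ : ξ ≠ 0)
    (h0 : ∀ i, eval ξ (pderiv i g) = 0) :
    (macaulay (d - 1) (fun i => pderiv i g)).det = 0 :=
  det_macaulay_eq_zero _
    (fun i => Literature.Algebra.Polynomial.JacobianCriterion.isHomogeneous_pderiv hg i) ξ hξ h0

/-- Contrapositive: a nonvanishing Macaulay determinant of the gradient certifies that the only
common zero of `∂_1 g, …, ∂_k g` is the origin (the cone `g = 0` is smooth away from `0`).
[cite: CoxLittleOSheaUsing2005, Ch. 3 §4, Exercise 7(a)] -/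
theorem eq_zero_of_det_macaulay_grad_ne_zero {k d : ℕ} (g : MvPolynomial (Fin k) K)
    (hg : g.IsHomogeneous d) (hdet : (macaulay (d - 1) (fun i => pderiv i g)).det ≠ 0)
    (ξ : Fin k → K) (h0 : ∀ i, eval ξ (pderiv i g) = 0) : ξ = 0 := by
  by_contra hξ
  exact hdet (det_macaulay_grad_eq_zero g hg ξ hξ h0)

end Macaulay

end Literature.RingTheory.MvPolynomial
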